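import Summits.ABC.StewartYu.PadicG3ExpLine
import Summits.ABC.StewartYu.PadicG3ParVN
import Summits.ABC.StewartYu.PadicG3OddHeadline1
import HarnessLib

/-!
# Cell abc-stewartyu, crux `Y07Odd` (stmt-ABC-19658), line `gen3-slab-odd`: the smallness exponent in the RECORD'S
# currency, both branches (`m = 0`: p1's `headline_V100_div_log_lit`; `m ≥ 1`: lp-1's `headline_odd1_div_log_lit`)

`Summits/ABC/StewartYu/PadicG3ExpLineP.lean` — cell `abc-stewartyu` (seat p2-g4, F-odd lead).  Theorems only, no named fact.

From the crux context of the two registered inequality stubs (`stub_ineqsV`, `stub_ineqs1` of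
`Summits/ABC/ABC/Cruxes/Y07Odd`: odd prime `p`, datum `S`, weights `(V, Vmax, W)`, the NEGATED bound with constant
`(2^{100})^n`, a parameter record `P` with `P.p = p`, `P.A = V`, `P.Amax ≤ Vmax`, `P.Amax ≤ 2ⁿ∏V`, `P.W = W`,
`P.Nq = P.K`, `P.K₀ = p − 1`, `P.θ₀ = ½`) this file produces the ONE exponent `E` the generic family glue
(`PadicG3OddLines.h*_of_lines`, p5-g4) consumes, already compared with the record's zeros × gain budget:
* `expLine_one` (`1 ≤ P.m`): `∃ E ≥ 1`, `‖Λ/b_{j₀}‖ ≤ (p^E)⁻¹`, `8·2ⁿ·(G·X·L) ≤ E·log p ≤ 8·2ⁿ·(G·X·L) + log p`;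
* `expLine_V` (`P.m = 0`): the same with the budget `8·2ⁿ·Zp + CondFloorV n`.
Mechanism: `PadicG3ExpLine.expLine_budget` with `B :=` half the headline; the headline's right side is `≤` the negated
bound's (`Ω = ∏V`, `Wp = W + log p + log 2Amax ≤ W + log p + log 2Vmax`), and `W + log p ≤ B`
(`W ≤ W_L ≤ G·X·L/64`, `log p ≤ G` for `m ≥ 1`; `W ≤ W_LV ≤ Zp/128`, `log p = 2G ≤ Zp/96` for `m = 0`).

References: K. Yu, Acta Math. 211 (2013) §7; Yu. V. Nesterenko, LNM 1819 (2003) §4.2.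
-/

noncomputable section

open Finset

namespace Summit.ABC.StewartYu

namespace G3Setup

variable {p : ℕ} [Fact p.Prime] (S : G3Setup p)

/-- The headline's right side is at most the negated bound's right side: `Ω = ∏V`, `Wp ≤ W + log p + log 2Vmax`.
[folklore] -/
theorem headline_rhs_le (V : Fin S.n → ℝ) (Vmax W : ℝ) (hV1 : ∀ j, 1 ≤ V j)
    (P : PadicG3Par S.n) (hPp : P.p = p) (hPA : P.A = V) (hAmaxV : P.Amax ≤ Vmax) (hPW : P.W = W) (c : ℝ) (hc : 0 ≤ c) :
    c * ((P.p : ℝ) / Real.log P.p) * P.Ω * P.Wp ≤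
      c * ((p : ℝ) / Real.log p) * (∏ j, V j) * (W + Real.log p + Real.log (2 * Vmax)) := by
  have hp : p.Prime := Fact.out
  have hp1 : (1 : ℝ) < p := by exact_mod_cast hp.one_lt
  have hlogp : 0 < Real.log p := Real.log_pos hp1
  have hΩ : P.Ω = ∏ j, V j := by unfold PadicG3Par.Ω; rw [hPA]
  have hWp : P.Wp ≤ W + Real.log p + Real.log (2 * Vmax) := by
    unfold PadicG3Par.Wp
    rw [hPW, hPp]
    have hA1 := P.hAmax1
    have : Real.log (2 * P.Amax) ≤ Real.log (2 * Vmax) :=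
      Real.log_le_log (by linarith) (by linarith)
    linarith
  have hprodV : 0 ≤ ∏ j, V j := prod_nonneg fun j _ => le_trans zero_le_one (hV1 j)
  rw [hΩ, hPp]
  have hpre : 0 ≤ c * ((p : ℝ) / Real.log p) * (∏ j, V j) := by positivity
  exact mul_le_mul_of_nonneg_left hWp hpre

/-- **Smallness exponent, branch `m ≥ 1`** (v1 record `PadicG3Par`): an `E ≥ 1` with `‖Λ/b_{j₀}‖_p ≤ (p^E)⁻¹` and
`8·2ⁿ·(G·X·L) ≤ E·log p ≤ 8·2ⁿ·(G·X·L) + log p`. [cite: Yu2013, §7; shape only] -/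
theorem expLine_one (hn2 : 2 ≤ S.n) (V : Fin S.n → ℝ) (Vmax W : ℝ)
    (hV1 : ∀ j, 1 ≤ V j) (hWb : ∀ j, Real.log (max 3 (|S.b j| : ℝ)) ≤ W)
    (hU : ¬ (padicValRat p (∏ j, S.α j ^ S.b j - 1) : ℝ) * Real.log p ≤
        ((2 : ℝ) ^ 100) ^ S.n * ((p : ℝ) / Real.log p) * (∏ j, V j) * (W + Real.log p + Real.log (2 * Vmax)))
    (P : PadicG3Par S.n) (hPp : P.p = p) (hPA : P.A = V) (hAmaxV : P.Amax ≤ Vmax)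
    (hAmaxPr : P.Amax ≤ 2 ^ S.n * ∏ j, V j) (hPW : P.W = W) (hNq : P.Nq = P.K) (hθ : P.θ₀ = 1 / 2) (hm : 1 ≤ P.m) :
    ∃ E : ℕ, 1 ≤ E ∧ ‖S.Λ / (S.b S.j₀ : ℚ_[p])‖ ≤ ((p : ℝ) ^ E)⁻¹ ∧
      8 * 2 ^ S.n * (P.G * P.X * P.L) ≤ (E : ℝ) * Real.log p ∧
      (E : ℝ) * Real.log p ≤ 8 * 2 ^ S.n * (P.G * P.X * P.L) + Real.log p := by
  have hp : p.Prime := Fact.out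
  have hp1 : (1 : ℝ) < p := by exact_mod_cast hp.one_lt
  have hlogp : 0 < Real.log p := Real.log_pos hp1
  have hA1 : ∀ j, 1 ≤ P.A j := fun j => by rw [hPA]; exact hV1 j
  have hAmaxΩ : P.Amax ≤ 2 ^ S.n * P.Ω := by unfold PadicG3Par.Ω; rw [hPA]; exact hAmaxPr
  -- the headline, compared with the negated bound's right side
  have hhead := P.headline_odd1_div_log_lit hn2 hm hθ hNq hAmaxΩ hA1
  have hrhs := S.headline_rhs_le V Vmax W hV1 P hPp hPA hAmaxV hPW (((2 : ℝ) ^ 100) ^ S.n) (by positivity)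
  set B : ℝ := 8 * 2 ^ S.n * (P.G * P.X * P.L) with hB
  have hB2 : 2 * B ≤ ((2 : ℝ) ^ 100) ^ S.n * ((p : ℝ) / Real.log p) * (∏ j, V j) *
      (W + Real.log p + Real.log (2 * Vmax)) := hhead.trans hrhs
  -- `W + log p ≤ B`
  have hG8 := P.eight_le_G
  have hG : 0 < P.G := by linarith
  have hL1 := P.one_le_L
  have hX72 := P.seventytwo_le_X
  have hWL1 := P.WL_ge_one
  have hWWL : P.W ≤ P.WL := by
    have h := P.W_add_log_le_WL
    have : 0 ≤ Real.log (2 * (P.L : ℝ)) := Real.log_nonneg (by linarith)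
    linarith
  have hWLB : P.WL ≤ P.G * P.X * P.L / 64 := by
    have h := P.WL_mul_le
    have hn1 : (1 : ℝ) ≤ (S.n : ℝ) + 1 := by
      have : (0 : ℝ) ≤ S.n := by positivity
      linarith
    have : P.WL ≤ (S.n + 1) * P.L * P.WL := by
      have h1 : (1 : ℝ) ≤ (S.n + 1) * P.L := by nlinarith
      nlinarith
    linarith
  have hlogG : Real.log p ≤ P.G := by
    have hG' : P.G = ((P.m : ℝ) + P.θ₀) * Real.log P.p := by
      unfold PadicG3Par.G PadicG3Par.θm; ring
    rw [hG', hθ, hPp]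
    have hm1 : (1 : ℝ) ≤ P.m := by exact_mod_cast hm
    nlinarith
  have hGB : P.G ≤ P.G * P.X * P.L := by
    have : 1 ≤ P.X * (P.L : ℝ) := by nlinarith
    nlinarith
  have hWB : W + Real.log p ≤ B := by
    rw [← hPW]
    have h2n : (1 : ℝ) ≤ 2 ^ S.n := one_le_pow₀ (by norm_num)
    have hGXL : 0 ≤ P.G * P.X * P.L := by positivity
    have : P.G * P.X * P.L ≤ B := by rw [hB]; nlinarith
    nlinarith
  obtain ⟨E, hE1, hΛ, hBE, hEB⟩ := S.expLine_budget hWb hU hB2 hWB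
  exact ⟨E, hE1, hΛ, hBE, hEB⟩

/-- **Smallness exponent, branch `m = 0`** (record `PadicG3ParV`): an `E ≥ 1` with `‖Λ/b_{j₀}‖_p ≤ (p^E)⁻¹` and
`8·2ⁿ·Zp + CondFloorV n ≤ E·log p ≤ 8·2ⁿ·Zp + CondFloorV n + log p`. [cite: Yu2013, §7; shape only] -/
theorem expLine_V (hn2 : 2 ≤ S.n) (V : Fin S.n → ℝ) (Vmax W : ℝ)
    (hV1 : ∀ j, 1 ≤ V j) (hWb : ∀ j, Real.log (max 3 (|S.b j| : ℝ)) ≤ W)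
    (hU : ¬ (padicValRat p (∏ j, S.α j ^ S.b j - 1) : ℝ) * Real.log p ≤
        ((2 : ℝ) ^ 100) ^ S.n * ((p : ℝ) / Real.log p) * (∏ j, V j) * (W + Real.log p + Real.log (2 * Vmax)))
    (P : PadicG3Par S.n) (hPp : P.p = p) (hPA : P.A = V) (hAmaxV : P.Amax ≤ Vmax)
    (hAmaxPr : P.Amax ≤ 2 ^ S.n * ∏ j, V j) (hPW : P.W = W) (hNq : P.Nq = P.K) (hK₀ : P.K₀ = p - 1)
    (hθ : P.θ₀ = 1 / 2) (hm : P.m = 0) :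
    ∃ E : ℕ, 1 ≤ E ∧ ‖S.Λ / (S.b S.j₀ : ℚ_[p])‖ ≤ ((p : ℝ) ^ E)⁻¹ ∧
      8 * 2 ^ S.n * P.Zp + P.CondFloorV S.n ≤ (E : ℝ) * Real.log p ∧
      (E : ℝ) * Real.log p ≤ 8 * 2 ^ S.n * P.Zp + P.CondFloorV S.n + Real.log p := by
  have hp : p.Prime := Fact.out
  have hp1 : (1 : ℝ) < p := by exact_mod_cast hp.one_lt
  have hp2 : (2 : ℝ) ≤ p := by exact_mod_cast hp.two_le
  have hlogp : 0 < Real.log p := Real.log_pos hp1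
  have hA1 : ∀ j, 1 ≤ P.A j := fun j => by rw [hPA]; exact hV1 j
  have hAmaxΩ : P.Amax ≤ 2 ^ S.n * P.Ω := by unfold PadicG3Par.Ω; rw [hPA]; exact hAmaxPr
  have hK₀R : (P.K₀ : ℝ) = P.p - 1 := by
    rw [hK₀, hPp]
    have h1 : 1 ≤ p := hp.one_lt.le
    push_cast [Nat.cast_sub h1]
    ring
  have hhead := P.headline_V100_div_log_lit hm hθ hn2 hA1 hAmaxΩ hNq hK₀R
  have hrhs := S.headline_rhs_le V Vmax W hV1 P hPp hPA hAmaxV hPW (((2 : ℝ) ^ 100) ^ S.n) (by positivity)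
  set B : ℝ := 8 * 2 ^ S.n * P.Zp + P.CondFloorV S.n with hB
  have hB2 : 2 * B ≤ ((2 : ℝ) ^ 100) ^ S.n * ((p : ℝ) / Real.log p) * (∏ j, V j) *
      (W + Real.log p + Real.log (2 * Vmax)) := hhead.trans hrhs
  -- `W + log p ≤ B`
  obtain ⟨hZp, hGX, _⟩ := P.Zp_facts
  have hG8 := P.eight_le_G
  have hX := P.sixtyfour_le_XV'
  have hWLV := P.WLV_le_Zp
  have hLV1 := P.one_le_LV
  have hWWLV : P.W ≤ P.WLV := by
    have h := P.W_add_log_le_WLV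
    have : 0 ≤ Real.log (2 * (P.LV : ℝ)) := Real.log_nonneg (by linarith)
    linarith
  have hlog2G : Real.log p = 2 * P.G := by
    have hG' : P.G = ((P.m : ℝ) + P.θ₀) * Real.log P.p := by
      unfold PadicG3Par.G PadicG3Par.θm; ring
    rw [hG', hθ, hPp, hm]
    push_cast
    ring
  have hGZ : P.G ≤ P.Zp / 192 := by
    have hn2R : (2 : ℝ) ≤ S.n := by exact_mod_cast hn2
    have h192 : (192 : ℝ) ≤ P.XV := by linarith
    have hG0 : 0 ≤ P.G := by linarith
    rw [le_div_iff₀ (by norm_num)]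
    nlinarith
  have hCF : 0 ≤ P.CondFloorV S.n := by
    unfold PadicG3Par.CondFloorV
    have hg := P.one_le_g
    have hX0 : (0 : ℝ) ≤ P.XV := by positivity
    have hpp : (0 : ℝ) < (P.p : ℝ) - 1 := by rw [hPp]; linarith
    have hlp : 0 ≤ Real.log (P.p : ℝ) := by rw [hPp]; exact hlogp.le
    positivity
  have hWB : W + Real.log p ≤ B := by
    rw [← hPW]
    have h2n : (1 : ℝ) ≤ 2 ^ S.n := one_le_pow₀ (by norm_num)
    have : P.Zp ≤ 8 * 2 ^ S.n * P.Zp := by nlinarith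
    rw [hB]
    linarith
  obtain ⟨E, hE1, hΛ, hBE, hEB⟩ := S.expLine_budget hWb hU hB2 hWB
  exact ⟨E, hE1, hΛ, hBE, hEB⟩

/-! ### Appendix (p2-g4, 2026-08-27T06:5xZ): the exponent from a budget of ANY admissible size

The headline certifies `2·B₀ ≤ R` for `B₀ = 8·2ⁿ·(G·X·L)` (resp. `8·2ⁿ·Zp + CondFloorV n`), while the loss of the
line is only `W + log p ≤ 2·G·X·L` (resp. `≤ Zp/48`); so budgets up to `14·2ⁿ·(G·X·L)` (resp. `(31/16)·B₀`) are
available for `E·log p` — p5-g4's `hexp*_sched1b` lines (`PadicG3OneExpLines`) consume `11·2ⁿ·(G·X·L) ≤ E·log p`. -/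

/-- **The smallness-exponent line with the exponent chosen by CEILING from a budget**: if `log p ≤ B` and
`B + log p + W ≤ R`, then `E := ⌈B/log p⌉` has `1 ≤ E`, `B ≤ E·log p ≤ B + log p` and `‖Λ/b_{j₀}‖ ≤ (p^E)⁻¹`.
[cite: Yu2013, §7; shape only] -/
theorem expLine_ceil {W : ℝ} (hWb : ∀ j, Real.log (max 3 (|S.b j| : ℝ)) ≤ W) {R : ℝ}
    (hU : ¬ (padicValRat p (∏ j, S.α j ^ S.b j - 1) : ℝ) * Real.log p ≤ R)
    {B : ℝ} (hB1 : Real.log p ≤ B) (hBR : B + Real.log p + W ≤ R) :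
    ∃ E : ℕ, 1 ≤ E ∧ ‖S.Λ / (S.b S.j₀ : ℚ_[p])‖ ≤ ((p : ℝ) ^ E)⁻¹ ∧ B ≤ (E : ℝ) * Real.log p ∧
      (E : ℝ) * Real.log p ≤ B + Real.log p := by
  have hp : p.Prime := Fact.out
  have hp1 : (1 : ℝ) < p := by exact_mod_cast hp.one_lt
  have hlogp : 0 < Real.log p := Real.log_pos hp1
  have hB : 0 < B := by linarith
  set E : ℕ := ⌈B / Real.log p⌉₊ with hEdef
  have hEge : B / Real.log p ≤ (E : ℝ) := Nat.le_ceil _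
  have hElt : (E : ℝ) < B / Real.log p + 1 := Nat.ceil_lt_add_one (div_nonneg hB.le hlogp.le)
  have hBE : B ≤ (E : ℝ) * Real.log p := by
    have := mul_le_mul_of_nonneg_right hEge hlogp.le
    rwa [div_mul_cancel₀ _ hlogp.ne'] at this
  have hEB : (E : ℝ) * Real.log p ≤ B + Real.log p := by
    have := mul_le_mul_of_nonneg_right hElt.le hlogp.le
    rw [add_mul, div_mul_cancel₀ _ hlogp.ne', one_mul] at this
    exact this
  have hE1 : 1 ≤ E := by
    have h1 : (1 : ℝ) ≤ B / Real.log p := by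
      rw [le_div_iff₀ hlogp, one_mul]; exact hB1
    have : (1 : ℝ) ≤ (E : ℝ) := h1.trans hEge
    exact_mod_cast this
  exact ⟨E, hE1, S.expLine_of_negBound hWb hU hE1 (by linarith), hBE, hEB⟩

/-- **Smallness exponent, branch `m ≥ 1`, with a budget `k·2ⁿ·(G·X·L)` for any `1 ≤ k ≤ 14`** (the headline pays
`16·2ⁿ·(G·X·L)`, the line loses `W + log p ≤ 2·G·X·L`). [cite: Yu2013, §7; shape only] -/
theorem expLine_one_gen (hn2 : 2 ≤ S.n) (V : Fin S.n → ℝ) (Vmax W : ℝ)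
    (hV1 : ∀ j, 1 ≤ V j) (hWb : ∀ j, Real.log (max 3 (|S.b j| : ℝ)) ≤ W)
    (hU : ¬ (padicValRat p (∏ j, S.α j ^ S.b j - 1) : ℝ) * Real.log p ≤
        ((2 : ℝ) ^ 100) ^ S.n * ((p : ℝ) / Real.log p) * (∏ j, V j) * (W + Real.log p + Real.log (2 * Vmax)))
    (P : PadicG3Par S.n) (hPp : P.p = p) (hPA : P.A = V) (hAmaxV : P.Amax ≤ Vmax)
    (hAmaxPr : P.Amax ≤ 2 ^ S.n * ∏ j, V j) (hPW : P.W = W) (hNq : P.Nq = P.K) (hθ : P.θ₀ = 1 / 2) (hm : 1 ≤ P.m)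
    {k : ℝ} (hk1 : 1 ≤ k) (hk : k ≤ 14) :
    ∃ E : ℕ, 1 ≤ E ∧ ‖S.Λ / (S.b S.j₀ : ℚ_[p])‖ ≤ ((p : ℝ) ^ E)⁻¹ ∧
      k * 2 ^ S.n * (P.G * P.X * P.L) ≤ (E : ℝ) * Real.log p ∧
      (E : ℝ) * Real.log p ≤ k * 2 ^ S.n * (P.G * P.X * P.L) + Real.log p := by
  have hp : p.Prime := Fact.out
  have hp1 : (1 : ℝ) < p := by exact_mod_cast hp.one_lt
  have hlogp : 0 < Real.log p := Real.log_pos hp1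
  have hA1 : ∀ j, 1 ≤ P.A j := fun j => by rw [hPA]; exact hV1 j
  have hAmaxΩ : P.Amax ≤ 2 ^ S.n * P.Ω := by unfold PadicG3Par.Ω; rw [hPA]; exact hAmaxPr
  have hhead := P.headline_odd1_div_log_lit hn2 hm hθ hNq hAmaxΩ hA1
  have hrhs := S.headline_rhs_le V Vmax W hV1 P hPp hPA hAmaxV hPW (((2 : ℝ) ^ 100) ^ S.n) (by positivity)
  have hR : 2 * (8 * 2 ^ S.n * (P.G * P.X * P.L)) ≤ ((2 : ℝ) ^ 100) ^ S.n * ((p : ℝ) / Real.log p) * (∏ j, V j) *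
      (W + Real.log p + Real.log (2 * Vmax)) := hhead.trans hrhs
  -- `W + log p ≤ 2·G·X·L`
  have hG8 := P.eight_le_G
  have hG : 0 < P.G := by linarith
  have hL1 := P.one_le_L
  have hX72 := P.seventytwo_le_X
  have hWL1 := P.WL_ge_one
  have hWWL : P.W ≤ P.WL := by
    have h := P.W_add_log_le_WL
    have : 0 ≤ Real.log (2 * (P.L : ℝ)) := Real.log_nonneg (by linarith)
    linarith
  have hWLB : P.WL ≤ P.G * P.X * P.L / 64 := by
    have h := P.WL_mul_le
    have hn1 : (1 : ℝ) ≤ (S.n : ℝ) + 1 := by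
      have : (0 : ℝ) ≤ S.n := by positivity
      linarith
    have : P.WL ≤ (S.n + 1) * P.L * P.WL := by
      have h1 : (1 : ℝ) ≤ (S.n + 1) * P.L := by nlinarith
      nlinarith
    linarith
  have hlogG : Real.log p ≤ P.G := by
    have hG' : P.G = ((P.m : ℝ) + P.θ₀) * Real.log P.p := by
      unfold PadicG3Par.G PadicG3Par.θm; ring
    rw [hG', hθ, hPp]
    have hm1 : (1 : ℝ) ≤ P.m := by exact_mod_cast hm
    nlinarith
  have hGB : P.G ≤ P.G * P.X * P.L := by
    have : 1 ≤ P.X * (P.L : ℝ) := by nlinarith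
    nlinarith
  have hGXL : 0 ≤ P.G * P.X * P.L := by positivity
  have h2n : (1 : ℝ) ≤ 2 ^ S.n := one_le_pow₀ (by norm_num)
  set Z : ℝ := P.G * P.X * P.L with hZ
  have hWZ : W + Real.log p ≤ 2 * Z := by rw [← hPW]; linarith
  have h2Z : 0 ≤ 2 ^ S.n * Z := by positivity
  have hkZ : k * 2 ^ S.n * Z = k * (2 ^ S.n * Z) := by ring
  have hB1 : Real.log p ≤ k * 2 ^ S.n * Z := by
    have h1 : 1 * (2 ^ S.n * Z) ≤ k * (2 ^ S.n * Z) := mul_le_mul_of_nonneg_right hk1 h2Z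
    have h2 : 1 * Z ≤ 2 ^ S.n * Z := mul_le_mul_of_nonneg_right h2n hGXL
    rw [hkZ]; linarith
  have hBR : k * 2 ^ S.n * Z + Real.log p + W ≤ ((2 : ℝ) ^ 100) ^ S.n * ((p : ℝ) / Real.log p) * (∏ j, V j) *
      (W + Real.log p + Real.log (2 * Vmax)) := by
    have h14 : k * (2 ^ S.n * Z) ≤ 14 * (2 ^ S.n * Z) := mul_le_mul_of_nonneg_right hk h2Z
    have h2 : 1 * Z ≤ 2 ^ S.n * Z := mul_le_mul_of_nonneg_right h2n hGXL
    have h16 : k * 2 ^ S.n * Z + 2 * Z ≤ 2 * (8 * 2 ^ S.n * Z) := by rw [hkZ]; linarith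
    linarith
  exact S.expLine_ceil hWb hU hB1 hBR

/-- **Smallness exponent, branch `m = 0`, with a budget `k·(8·2ⁿ·Zp + CondFloorV n)` for any `1 ≤ k ≤ 31/16`** (the
headline pays twice the unit, the line loses `W + log p ≤ Zp/48`). [cite: Yu2013, §7; shape only] -/
theorem expLine_V_gen (hn2 : 2 ≤ S.n) (V : Fin S.n → ℝ) (Vmax W : ℝ)
    (hV1 : ∀ j, 1 ≤ V j) (hWb : ∀ j, Real.log (max 3 (|S.b j| : ℝ)) ≤ W)
    (hU : ¬ (padicValRat p (∏ j, S.α j ^ S.b j - 1) : ℝ) * Real.log p ≤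
        ((2 : ℝ) ^ 100) ^ S.n * ((p : ℝ) / Real.log p) * (∏ j, V j) * (W + Real.log p + Real.log (2 * Vmax)))
    (P : PadicG3Par S.n) (hPp : P.p = p) (hPA : P.A = V) (hAmaxV : P.Amax ≤ Vmax)
    (hAmaxPr : P.Amax ≤ 2 ^ S.n * ∏ j, V j) (hPW : P.W = W) (hNq : P.Nq = P.K) (hK₀ : P.K₀ = p - 1)
    (hθ : P.θ₀ = 1 / 2) (hm : P.m = 0) {k : ℝ} (hk1 : 1 ≤ k) (hk : k ≤ 31 / 16) :
    ∃ E : ℕ, 1 ≤ E ∧ ‖S.Λ / (S.b S.j₀ : ℚ_[p])‖ ≤ ((p : ℝ) ^ E)⁻¹ ∧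
      k * (8 * 2 ^ S.n * P.Zp + P.CondFloorV S.n) ≤ (E : ℝ) * Real.log p ∧
      (E : ℝ) * Real.log p ≤ k * (8 * 2 ^ S.n * P.Zp + P.CondFloorV S.n) + Real.log p := by
  have hp : p.Prime := Fact.out
  have hp1 : (1 : ℝ) < p := by exact_mod_cast hp.one_lt
  have hp2 : (2 : ℝ) ≤ p := by exact_mod_cast hp.two_le
  have hlogp : 0 < Real.log p := Real.log_pos hp1
  have hA1 : ∀ j, 1 ≤ P.A j := fun j => by rw [hPA]; exact hV1 j
  have hAmaxΩ : P.Amax ≤ 2 ^ S.n * P.Ω := by unfold PadicG3Par.Ω; rw [hPA]; exact hAmaxPr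
  have hK₀R : (P.K₀ : ℝ) = P.p - 1 := by
    rw [hK₀, hPp]
    have h1 : 1 ≤ p := hp.one_lt.le
    push_cast [Nat.cast_sub h1]
    ring
  have hhead := P.headline_V100_div_log_lit hm hθ hn2 hA1 hAmaxΩ hNq hK₀R
  have hrhs := S.headline_rhs_le V Vmax W hV1 P hPp hPA hAmaxV hPW (((2 : ℝ) ^ 100) ^ S.n) (by positivity)
  have hR : 2 * (8 * 2 ^ S.n * P.Zp + P.CondFloorV S.n) ≤ ((2 : ℝ) ^ 100) ^ S.n * ((p : ℝ) / Real.log p) *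
      (∏ j, V j) * (W + Real.log p + Real.log (2 * Vmax)) := hhead.trans hrhs
  obtain ⟨hZp, hGX, _⟩ := P.Zp_facts
  have hG8 := P.eight_le_G
  have hX := P.sixtyfour_le_XV'
  have hWLV := P.WLV_le_Zp
  have hLV1 := P.one_le_LV
  have hWWLV : P.W ≤ P.WLV := by
    have h := P.W_add_log_le_WLV
    have : 0 ≤ Real.log (2 * (P.LV : ℝ)) := Real.log_nonneg (by linarith)
    linarith
  have hlog2G : Real.log p = 2 * P.G := by
    have hG' : P.G = ((P.m : ℝ) + P.θ₀) * Real.log P.p := by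
      unfold PadicG3Par.G PadicG3Par.θm; ring
    rw [hG', hθ, hPp, hm]
    push_cast
    ring
  have hGZ : P.G ≤ P.Zp / 192 := by
    have hn2R : (2 : ℝ) ≤ S.n := by exact_mod_cast hn2
    have h192 : (192 : ℝ) ≤ P.XV := by linarith
    have hG0 : 0 ≤ P.G := by linarith
    rw [le_div_iff₀ (by norm_num)]
    nlinarith
  have hCF : 0 ≤ P.CondFloorV S.n := by
    unfold PadicG3Par.CondFloorV
    have hg := P.one_le_g
    have hX0 : (0 : ℝ) ≤ P.XV := by positivity
    have hpp : (0 : ℝ) < (P.p : ℝ) - 1 := by rw [hPp]; linarith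
    have hlp : 0 ≤ Real.log (P.p : ℝ) := by rw [hPp]; exact hlogp.le
    positivity
  have h2n : (4 : ℝ) ≤ 2 ^ S.n := by
    have h := pow_le_pow_right₀ (by norm_num : (1 : ℝ) ≤ 2) hn2
    norm_num at h
    exact h
  set BV : ℝ := 8 * 2 ^ S.n * P.Zp + P.CondFloorV S.n with hBV
  have hWZ : W + Real.log p ≤ P.Zp / 48 := by rw [← hPW]; linarith
  have h4 : 4 * P.Zp ≤ 2 ^ S.n * P.Zp := mul_le_mul_of_nonneg_right h2n hZp.le
  have hZBV : 32 * P.Zp ≤ BV := by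
    have : 8 * 2 ^ S.n * P.Zp = 8 * (2 ^ S.n * P.Zp) := by ring
    rw [hBV, this]; linarith
  have hBV0 : 0 ≤ BV := by linarith
  have hB1 : Real.log p ≤ k * BV := by
    have h1 : 1 * BV ≤ k * BV := mul_le_mul_of_nonneg_right hk1 hBV0
    linarith
  have hBR : k * BV + Real.log p + W ≤ ((2 : ℝ) ^ 100) ^ S.n * ((p : ℝ) / Real.log p) * (∏ j, V j) *
      (W + Real.log p + Real.log (2 * Vmax)) := by
    have h31 : k * BV ≤ (31 / 16) * BV := mul_le_mul_of_nonneg_right hk hBV0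
    have h16 : k * BV + P.Zp / 48 ≤ 2 * BV := by linarith
    linarith
  exact S.expLine_ceil hWb hU hB1 hBR

end G3Setup

end Summit.ABC.StewartYu

end
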